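import Summits.QuantumFields.YangMills.Theorems.SwapVirialDeficitSwapRingDeficit
import HarnessLib

/-!
# The LOG-DERIVATIVE OF THE σ-GLUED TRACE IN DEFICIT FORM: `b·(log Z^S(L,b,2L))′ = 12bL⁴ − b·Σ_z ∫F^S_z e^{−bF^S_z}dμ_L / Σ_z ∫e^{−bF^S_z}dμ_L`
# (file D1 of the V2′ virial assembly; free-hands support of ⟨stmt-QuantumFields-24197⟩ `SwapVirialDeficit.SwapGluedStiffness`)

The crux ⟨24197⟩ is a bound on `β·(log Z^S)′(β)`, `Z^S(b) = TT.twistTrace L b (2L) = (1/8) Σ_z e^{12bL⁴} ∫ e^{−bF^S_z} dμ_L`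
(✓`SwapRing.twistTrace_eq_sum_exp_mul_integral_deficit`).  This file computes that log-derivative EXACTLY in terms of the sector Laplace integrals
`Z_z(b) = ∫ e^{−bF^S_z} dμ_L` and the sector mean actions `E_z(b) = ∫ F^S_z e^{−bF^S_z} dμ_L`:
* §1 `exists_abs_swapRingExponent_le`, `exists_abs_swapRingDeficit_le` (the σ-glued exponent ∕ deficit are bounded), integrability of `e^{−bF}`, `F e^{−bF}`;
  `twistTrace_eq_sum_integral_exp_exponent` (`Z^S = (1/8) Σ_z ∫ e^{bΨ^S_z} dμ_L`);
* §2 ★ `hasDerivAt_twistTrace` — `(Z^S)′(b) = (1/8) Σ_z ∫ Ψ^S_z e^{bΨ^S_z} dμ_L` (✓`SectorSmooth.hasDerivAt_integral_exp_mul`), and in deficit form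
  ★ `hasDerivAt_twistTrace_deficit` — `(Z^S)′(b) = (1/8) e^{12bL⁴} (12L⁴·Σ_z Z_z(b) − Σ_z E_z(b))`;
* §3 ★★ `mul_deriv_log_twistTrace_eq` — `b·(log Z^S)′(b) = 12bL⁴ − b·(Σ_z E_z(b)) / (Σ_z Z_z(b))`, with `sum_integral_exp_swapDeficit_pos`.
Combined with the virial decomposition of each `b·E_z(b)` (✓`BlowUpRing.virial_chart_decomposition` through the joint gnomonic ring chart) this turns the
crux's window row into the virial-window inequality `½⟪W⟫ − b⟪R⟫ ≤ (1/2 − c)·Σ_z Z_z` (file D2).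
HONEST LABEL: exact fixed-`L` calculus; nothing about the window is proved; ⟨24197⟩ ∕ ⟨24194⟩ ∕ ⟨24196⟩ ∕ ⟨24497⟩ OPEN; the Yang–Mills mass gap is NOT proved;
no summit is proved by a line.  Seat ym-line-fcl-p3 g46 (cell ym-idea-1, free hands; item of record ⟨24085⟩ aside, untouched), `--supports stmt-QuantumFields-24197`.
THEOREMS ONLY, 0 `sorry`, standard axioms.  References: [cite: tHooft1979]; [cite: MontvayMunster1994, (3.145)]; [folklore].
-/

set_option autoImplicit false

noncomputable section

open MeasureTheory Set Filter Topology
open scoped BigOperators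
open Literature.MathematicalPhysics.QuantumFieldTheory hiding SU2
open Summit.QuantumFields.YangMills.Theorems.FemtoTransferGap
open Summit.QuantumFields.YangMills.Theorems.FemtoTransferGap.TT
open Summit.QuantumFields.YangMills.Theorems.FemtoTransferGap.TT.SectorSmooth
open Summit.QuantumFields.YangMills.Theorems.VirialFluxGap.RingDeficit

namespace Summit.QuantumFields.YangMills.Theorems.SwapVirialDeficit.SwapRing

variable {L : ℕ} [NeZero L]

/-! ## §1 Boundedness and the exponent form of the trace -/

/-- The σ-glued exponent is bounded: `∃ B, ∀ p, |Ψ^S_z(p)| ≤ B`. [folklore] -/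
theorem exists_abs_swapRingExponent_le (z : Fin 3 → Bool) :
    ∃ B : ℝ, ∀ p : (Fin (2 * L - 1 + 1) → GaugeConfig 3 L SU2) × (Site 3 L → SU2), |swapRingExponent L z p| ≤ B :=
  exists_abs_log_swapSeamChain_one_le (L := L) (2 * L - 1) z

/-- The σ-glued deficit is bounded: `∃ B, ∀ p, |F^S_z(p)| ≤ B`. [folklore] -/
theorem exists_abs_swapRingDeficit_le (z : Fin 3 → Bool) :
    ∃ B : ℝ, ∀ p : (Fin (2 * L - 1 + 1) → GaugeConfig 3 L SU2) × (Site 3 L → SU2), |swapRingDeficit L z p| ≤ B := by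
  obtain ⟨B, hB⟩ := exists_abs_swapRingExponent_le (L := L) z
  refine ⟨12 * (L : ℝ) ^ 4 + B, fun p => ?_⟩
  unfold swapRingDeficit
  have h := hB p
  have h12 : |12 * (L : ℝ) ^ 4| = 12 * (L : ℝ) ^ 4 := abs_of_nonneg (by positivity)
  calc |12 * (L : ℝ) ^ 4 - swapRingExponent L z p| ≤ |12 * (L : ℝ) ^ 4| + |swapRingExponent L z p| := abs_sub _ _
    _ ≤ 12 * (L : ℝ) ^ 4 + B := by rw [h12]; linarith

/-- `e^{−bF^S_z}` is integrable against `μ_L`. [folklore] -/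
theorem integrable_exp_swapDeficit (z : Fin 3 → Bool) (b : ℝ) :
    Integrable (fun p => Real.exp (-(b * swapRingDeficit L z p))) (ringMeasure L) := by
  haveI : IsProbabilityMeasure (ringMeasure L) := isProbabilityMeasure_ringMeasure (L := L)
  obtain ⟨B, hB⟩ := exists_abs_swapRingDeficit_le (L := L) z
  refine Integrable.mono' (integrable_const (Real.exp (|b| * B))) (((measurable_swapRingDeficit z).const_mul b).neg.exp.aestronglyMeasurable)
    (ae_of_all _ fun p => ?_)
  rw [Real.norm_eq_abs, abs_of_pos (Real.exp_pos _)]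
  refine Real.exp_le_exp.2 ?_
  have h1 : -(b * swapRingDeficit L z p) ≤ |b * swapRingDeficit L z p| := neg_le_abs _
  rw [abs_mul] at h1
  exact h1.trans (mul_le_mul_of_nonneg_left (hB p) (abs_nonneg b))

/-- `F^S_z·e^{−bF^S_z}` is integrable against `μ_L`. [folklore] -/
theorem integrable_swapDeficit_mul_exp (z : Fin 3 → Bool) (b : ℝ) :
    Integrable (fun p => swapRingDeficit L z p * Real.exp (-(b * swapRingDeficit L z p))) (ringMeasure L) := by
  obtain ⟨B, hB⟩ := exists_abs_swapRingDeficit_le (L := L) z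
  refine Integrable.mono' ((integrable_exp_swapDeficit z b).norm.const_mul B)
    ((measurable_swapRingDeficit z).mul ((measurable_swapRingDeficit z).const_mul b).neg.exp).aestronglyMeasurable (ae_of_all _ fun p => ?_)
  rw [Real.norm_eq_abs, abs_mul, Real.norm_eq_abs]
  exact mul_le_mul_of_nonneg_right (hB p) (abs_nonneg _)

/-- `Z^S(L,b,2L) = (1/8) Σ_z ∫ e^{bΨ^S_z} dμ_L` (the exponential-tilt form of ✓`twistTrace_eq_sum_exp_mul_integral_deficit`). [cite: tHooft1979] -/
theorem twistTrace_eq_sum_integral_exp_exponent (b : ℝ) :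
    TT.twistTrace L b (2 * L) = (1 / 8 : ℝ) * ∑ z : Fin 3 → Bool, ∫ p, Real.exp (b * swapRingExponent L z p) ∂(ringMeasure L) := by
  rw [twistTrace_eq_sum_exp_mul_integral_deficit]
  congr 1
  refine Finset.sum_congr rfl fun z _ => ?_
  rw [← integral_const_mul]
  refine integral_congr_ae (ae_of_all _ fun p => ?_)
  dsimp only
  rw [← Real.exp_add]
  congr 1
  unfold swapRingDeficit
  ring

/-! ## §2 The derivative of the σ-glued trace -/

/-- ★ **`(Z^S)′(b) = (1/8) Σ_z ∫ Ψ^S_z e^{bΨ^S_z} dμ_L`** (differentiation under the integral of a bounded exponential tilt,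
✓`SectorSmooth.hasDerivAt_integral_exp_mul`). [cite: tHooft1979] [cite: MontvayMunster1994, (3.145)] -/
theorem hasDerivAt_twistTrace (b : ℝ) :
    HasDerivAt (fun x : ℝ => TT.twistTrace L x (2 * L))
      ((1 / 8 : ℝ) * ∑ z : Fin 3 → Bool, ∫ p, swapRingExponent L z p * Real.exp (b * swapRingExponent L z p) ∂(ringMeasure L)) b := by
  haveI : IsProbabilityMeasure (ringMeasure L) := isProbabilityMeasure_ringMeasure (L := L)
  have hfun : (fun x : ℝ => TT.twistTrace L x (2 * L)) =
      fun x => (1 / 8 : ℝ) * ∑ z : Fin 3 → Bool, ∫ p, Real.exp (x * swapRingExponent L z p) ∂(ringMeasure L) :=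
    funext fun x => twistTrace_eq_sum_integral_exp_exponent x
  rw [hfun]
  refine HasDerivAt.const_mul _ (HasDerivAt.fun_sum fun z _ => ?_)
  obtain ⟨B, hB⟩ := exists_abs_swapRingExponent_le (L := L) z
  exact hasDerivAt_integral_exp_mul (ringMeasure L) (measurable_swapRingExponent z) hB b

/-- The tilt derivative in deficit form: `∫ Ψ e^{bΨ} dμ_L = e^{12bL⁴}·(12L⁴·∫e^{−bF}dμ_L − ∫F e^{−bF}dμ_L)`. [folklore] -/
theorem integral_exponent_mul_exp_eq (z : Fin 3 → Bool) (b : ℝ) :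
    ∫ p, swapRingExponent L z p * Real.exp (b * swapRingExponent L z p) ∂(ringMeasure L) =
      Real.exp (12 * b * (L : ℝ) ^ 4) * (12 * (L : ℝ) ^ 4 * (∫ p, Real.exp (-(b * swapRingDeficit L z p)) ∂(ringMeasure L))
        - ∫ p, swapRingDeficit L z p * Real.exp (-(b * swapRingDeficit L z p)) ∂(ringMeasure L)) := by
  rw [← integral_const_mul, ← integral_sub ((integrable_exp_swapDeficit z b).const_mul _) (integrable_swapDeficit_mul_exp z b), ← integral_const_mul]
  refine integral_congr_ae (ae_of_all _ fun p => ?_)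
  have hΨ : swapRingExponent L z p = 12 * (L : ℝ) ^ 4 - swapRingDeficit L z p := by unfold swapRingDeficit; ring
  have hE : Real.exp (b * swapRingExponent L z p) = Real.exp (12 * b * (L : ℝ) ^ 4) * Real.exp (-(b * swapRingDeficit L z p)) := by
    rw [← Real.exp_add]; congr 1; rw [hΨ]; ring
  dsimp only
  rw [hE, hΨ]
  ring

/-- ★ **`(Z^S)′` IN DEFICIT FORM**: `(Z^S)′(b) = (1/8)·e^{12bL⁴}·(12L⁴·Σ_z Z_z(b) − Σ_z E_z(b))`, `Z_z = ∫e^{−bF^S_z}dμ_L`, `E_z = ∫F^S_z e^{−bF^S_z}dμ_L`.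
[cite: tHooft1979] -/
theorem hasDerivAt_twistTrace_deficit (b : ℝ) :
    HasDerivAt (fun x : ℝ => TT.twistTrace L x (2 * L))
      ((1 / 8 : ℝ) * (Real.exp (12 * b * (L : ℝ) ^ 4) *
        (12 * (L : ℝ) ^ 4 * (∑ z : Fin 3 → Bool, ∫ p, Real.exp (-(b * swapRingDeficit L z p)) ∂(ringMeasure L))
          - ∑ z : Fin 3 → Bool, ∫ p, swapRingDeficit L z p * Real.exp (-(b * swapRingDeficit L z p)) ∂(ringMeasure L)))) b := by
  refine (hasDerivAt_twistTrace b).congr_deriv ?_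
  congr 1
  simp_rw [integral_exponent_mul_exp_eq]
  rw [← Finset.mul_sum, Finset.sum_sub_distrib, Finset.mul_sum]

/-! ## §3 The log-derivative of the σ-glued trace -/

/-- `Σ_z Z_z(b) > 0`. [folklore] -/
theorem sum_integral_exp_swapDeficit_pos (b : ℝ) :
    0 < ∑ z : Fin 3 → Bool, ∫ p, Real.exp (-(b * swapRingDeficit L z p)) ∂(ringMeasure L) := by
  haveI : IsProbabilityMeasure (ringMeasure L) := isProbabilityMeasure_ringMeasure (L := L)
  refine Finset.sum_pos (fun z _ => ?_) Finset.univ_nonempty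
  exact integral_exp_pos (integrable_exp_swapDeficit z b)

/-- `Z^S(L,b,2L) = (1/8)·e^{12bL⁴}·Σ_z Z_z(b)`. [cite: tHooft1979] -/
theorem twistTrace_eq_exp_mul_sum (b : ℝ) :
    TT.twistTrace L b (2 * L) =
      (1 / 8 : ℝ) * (Real.exp (12 * b * (L : ℝ) ^ 4) * ∑ z : Fin 3 → Bool, ∫ p, Real.exp (-(b * swapRingDeficit L z p)) ∂(ringMeasure L)) := by
  rw [twistTrace_eq_sum_exp_mul_integral_deficit, ← Finset.mul_sum]

/-- ★★ **THE LOG-DERIVATIVE OF THE σ-GLUED TRACE IN DEFICIT FORM**: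
`b·(log Z^S(L,·,2L))′(b) = 12bL⁴ − b·(Σ_z E_z(b)) / (Σ_z Z_z(b))` — the crux's left-hand side through the sector mean actions. [cite: tHooft1979] -/
theorem mul_deriv_log_twistTrace_eq (b : ℝ) :
    b * deriv (fun x : ℝ => Real.log (TT.twistTrace L x (2 * L))) b =
      12 * b * (L : ℝ) ^ 4 - b * ((∑ z : Fin 3 → Bool, ∫ p, swapRingDeficit L z p * Real.exp (-(b * swapRingDeficit L z p)) ∂(ringMeasure L))
        / ∑ z : Fin 3 → Bool, ∫ p, Real.exp (-(b * swapRingDeficit L z p)) ∂(ringMeasure L)) := by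
  set S : ℝ := ∑ z : Fin 3 → Bool, ∫ p, Real.exp (-(b * swapRingDeficit L z p)) ∂(ringMeasure L) with hS
  set E : ℝ := ∑ z : Fin 3 → Bool, ∫ p, swapRingDeficit L z p * Real.exp (-(b * swapRingDeficit L z p)) ∂(ringMeasure L) with hE
  have hSpos : 0 < S := sum_integral_exp_swapDeficit_pos b
  have hT : TT.twistTrace L b (2 * L) = (1 / 8 : ℝ) * (Real.exp (12 * b * (L : ℝ) ^ 4) * S) := twistTrace_eq_exp_mul_sum b
  have hTpos : 0 < TT.twistTrace L b (2 * L) := by rw [hT]; positivity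
  have hd := hasDerivAt_twistTrace_deficit (L := L) b
  have hlog := hd.log hTpos.ne'
  rw [hlog.deriv, hT]
  have hexp : Real.exp (12 * b * (L : ℝ) ^ 4) ≠ 0 := (Real.exp_pos _).ne'
  field_simp
  ring

end Summit.QuantumFields.YangMills.Theorems.SwapVirialDeficit.SwapRing

end
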